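import Summits.AtomisticToContinuum.HydrodynamicLimit.Theses.JParityClosure
import Summits.AtomisticToContinuum.HydrodynamicLimit.Theorems.JParityClosureParityBandClosureInverseCollisionInvariance
import Summits.AtomisticToContinuum.HydrodynamicLimit.Theorems.JParityClosureParityBandClosureDetailedBalanceOfSymmetricRecord
import Summits.AtomisticToContinuum.HydrodynamicLimit.Theorems.JParityClosureParityBandClosureProductionZeroOfDetailedBalance
import Summits.AtomisticToContinuum.HydrodynamicLimit.Theorems.JParityClosureParityBandClosureIsotropyOfVanishingProduction
import Summits.AtomisticToContinuum.HydrodynamicLimit.Theorems.JParityClosureParityRigidityMollify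
import Summits.AtomisticToContinuum.HydrodynamicLimit.Theorems.JParityClosureRateFloorGainSpreading
import Mathlib.MeasureTheory.Measure.ProbabilityMeasure
import HarnessLib

/-!
# Exact parity rigidity (stub `stub_exactParityRigidity`)

Stub of the line `transfer-weighted-parity-chain` (skeleton v3) of the crux
`JParityClosure.ParityBandClosure` (stmt-AtomisticToContinuum-17608): the `η = 0` case of the
line's parity-stability lemma.

WHAT. Let `ν` be a probability law on `V3 = ℝ³` with finite second moment and `κ` a finite
collision record on `Q = (V3 × V3) × S²` (pre-collisional pair, impact direction) with finite
second moments. Write `h_ϑ = ν ⋆ G_{ϑ²}` for the Gaussian KDE of `ν` at bandwidth `ϑ`,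
`F_ϑ(q) = log h(v) + log h(w) − log h(v′) − log h(w′)` for the surprisal jump across the record
`q = ((v, w), ω)`, `(v′, w′) = collide ω (v, w)`, `J q = (collide ω (v, w), −ω)` for the inverse
collision and `B q = ((w − v)·ω)₊` for the flux weight. ASSUME (o) every bounded continuous
`J`-odd test integrates to zero against `min(1, e^{−F_ϑ}) · κ` for every `ϑ ∈ (0, 1)`, (f) the
ideal contact law `B · ((ν ⊗ ν) ⊗ σ)` is absolutely continuous w.r.t. `κ`, (b) the gain marginals
of `κ` equal its loss marginals (a measure identity on `V3`). THEN `ν` has a mean `u` and exactly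
isotropic central second moments `θ 𝟙`, `θ ≥ 0`.

PROOF SKETCH (composition of the landed chain). Fix `ϑ ∈ (0, 1)` and put `c = log ∘ h_ϑ`.
(1) `|c(v)| ≤ A + ‖v‖²/ϑ²` (`exists_abs_log_kde_le`): from above `h_ϑ ≤ (2πϑ²)^{-3/2}` since the
Gaussian kernel is `≤ 1` and `ν` is a probability; from below restrict the Gaussian average to a
closed ball `B̄(0, R)` of positive `ν`-mass and use `e^{−‖v − v′‖²/(2ϑ²)} ≥ e^{−(‖v‖² + R²)/ϑ²}`
there. (2) With energy conservation of `collide` the four compositions `c ∘ pre₁, c ∘ pre₂,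
c ∘ post₁, c ∘ post₂` are `κ`-integrable, so `F_ϑ` is `κ`-integrable and, pushing forward
(`integral_map`) and using (b), `∫ F_ϑ dκ = 0` (`integral_jump_eq_zero`). (3) `F_ϑ ∘ J = −F_ϑ`
(`collide (−ω) = collide ω`, `collide ω` an involution). (4) By (o) and
`stub_mapInverseCollisionOfOddIntegrals` (p139072) the reweighted record `min(1, e^{−F_ϑ}) · κ` is
`J`-invariant. (5) `stub_detailedBalanceOfSymmetricRecord` (p138663) with (f): `F_ϑ = 0` a.e. for
the ideal contact law. (6) `stub_productionZeroOfDetailedBalance` (p139366): the even entropy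
production of `ν` at bandwidth `ϑ` vanishes. (7) This holds for every `ϑ ∈ (0, 1)`, so
`stub_isotropyOfVanishingProduction` (p137939, `ϑ₀ = 1`) gives the isotropy.

REFERENCES. C. Cercignani, R. Illner, M. Pulvirenti, *The Mathematical Theory of Dilute Gases*,
1994, §3.1–3.2 (micro-reversibility and the equality case of the H-theorem); the KDE bounds are
elementary Gaussian estimates.
-/

noncomputable section

namespace Summit.AtomisticToContinuum.HydrodynamicLimit.Theorems.ParityBandClosureExactRigidity

open scoped BigOperators Topology Classical MeasureTheory ENNReal InnerProductSpace
open Filter Set MeasureTheory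
open Literature.MathematicalPhysics.KineticTheory Literature.Analysis.FluidPDE

/-! ## §0 The statement (verbatim copy of the skeleton's `ExactParityRigidity`) -/

/-- **Exact parity rigidity** (the `η = 0` case of `ParityStability`; OWN waypoint of v3).  A probability law `ν` on `ℝ³`
with finite second moment and a finite record `κ` on `Q` with finite second moments such that (o) at EVERY bandwidth
`ϑ ∈ (0,1)` every bounded continuous `J`-odd test integrates to zero against the Metropolis-reweighted record
`min(1,e^{−F^ν_ϑ})·κ`, (f) the ideal contact law `π(ν) = B·((ν⊗ν)⊗σ)` is absolutely continuous w.r.t. `κ`, and (b) the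
record is collisionally balanced as a MEASURE identity (gain marginals = loss marginals on `ℝ³`), has EXACTLY isotropic
central second moments.  Proof = the landed chain: (o) ⇒ `J`-invariance of the reweighted record (p139072
`stub_mapInverseCollisionOfOddIntegrals`); (b) + `|log h_ϑ(v)| ≤ C_ϑ(1+|v|²)` + energy conservation of `collide` ⇒
`F_ϑ` is `κ`-integrable with `∫F_ϑ dκ = 0` (`integral_map` four times); `F_ϑ ∘ J = −F_ϑ` (`collide_neg_dir`,
`collide_collide`); p138663 `stub_detailedBalanceOfSymmetricRecord` with (f) ⇒ `F_ϑ = 0` `π(ν)`-a.e.; p139366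
`stub_productionZeroOfDetailedBalance` ⇒ the even production vanishes at every `ϑ ∈ (0,1)`; p137939
`stub_isotropyOfVanishingProduction` (`ϑ₀ = 1`) ⇒ isotropy.  Analytic facts on `h_ϑ`: `ParityRigidityMollify`
(`integral_localMaxwellian_pos`, `measurable_integral_localMaxwellian`, `integral_localMaxwellian_eq`, `surprisal_eq`). -/
def ExactParityRigidity : Prop :=
  ∀ (ν : Measure V3) [IsProbabilityMeasure ν] (κ : Measure ((V3 × V3) × Metric.sphere (0 : V3) 1))
    [IsFiniteMeasure κ],
    Integrable (fun v : V3 => ‖v‖ ^ 2) ν →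
    Integrable (fun q : (V3 × V3) × Metric.sphere (0 : V3) 1 => ‖q.1.1‖ ^ 2 + ‖q.1.2‖ ^ 2) κ →
    let h : ℝ → V3 → ℝ := fun ϑ v => ∫ v', localMaxwellian 1 (ϑ ^ 2) v v' ∂ν
    let F : ℝ → (V3 × V3) × Metric.sphere (0 : V3) 1 → ℝ := fun ϑ q =>
      Real.log (h ϑ q.1.1) + Real.log (h ϑ q.1.2) -
        Real.log (h ϑ (collide q.2 q.1).1) - Real.log (h ϑ (collide q.2 q.1).2)
    (∀ ϑ : ℝ, 0 < ϑ → ϑ < 1 → ∀ Ψ : (V3 × V3) × Metric.sphere (0 : V3) 1 → ℝ, Continuous Ψ →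
      (∃ C : ℝ, ∀ q, |Ψ q| ≤ C) → (∀ q, Ψ (collide q.2 q.1, -q.2) = -Ψ q) →
      ∫ q, Ψ q * min 1 (Real.exp (-(F ϑ q))) ∂κ = 0) →
    (((ν.prod ν).prod sphereMeasure).withDensity
        (fun q => ENNReal.ofReal (hardSphereKernel (q.1.2, q.1.1) q.2))) ≪ κ →
    κ.map (fun q => (collide q.2 q.1).1) + κ.map (fun q => (collide q.2 q.1).2) =
      κ.map (fun q => q.1.1) + κ.map (fun q => q.1.2) →
    ∃ θ : ℝ, 0 ≤ θ ∧ ∃ u : V3, (∀ j : Fin 3, ∫ v, v j ∂ν = u j) ∧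
      ∀ j k : Fin 3, ∫ v, (v j - u j) * (v k - u k) ∂ν = (if j = k then θ else 0)

/-! ## §1 Quadratic bound on the logarithm of the Gaussian KDE -/

/-- Every probability measure on `V3` charges some closed ball centred at the origin (the balls
`B̄(0, n)`, `n ∈ ℕ`, exhaust the space). [folklore] -/
theorem exists_measureReal_closedBall_pos (ν : Measure V3) [IsProbabilityMeasure ν] :
    ∃ R : ℝ, 0 < ν.real (Metric.closedBall (0 : V3) R) := by
  by_contra hcon
  push Not at hcon
  have h0 : ∀ n : ℕ, ν (Metric.closedBall (0 : V3) n) = 0 := fun n =>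
    (measureReal_eq_zero_iff (measure_ne_top ν _)).1 (le_antisymm (hcon n) measureReal_nonneg)
  have huniv : ν (univ : Set V3) = 0 := by
    rw [← Metric.iUnion_closedBall_nat (0 : V3)]
    exact measure_iUnion_null h0
  exact one_ne_zero (measure_univ.symm.trans huniv)

/-- Gaussian kernel floor on a closed ball: for `‖v′‖ ≤ R`,
`e^{−(‖v‖² + R²)/ϑ²} ≤ e^{−‖v − v′‖²/(2ϑ²)}` (since `‖v − v′‖² ≤ 2‖v‖² + 2R²`). [folklore] -/
theorem exp_neg_le_exp_neg_norm_sub_sq {R ϑ : ℝ} (hϑ : 0 < ϑ) (v v' : V3)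
    (hv' : v' ∈ Metric.closedBall (0 : V3) R) :
    Real.exp (-(‖v‖ ^ 2 + R ^ 2) / ϑ ^ 2) ≤ Real.exp (-‖v - v'‖ ^ 2 / (2 * ϑ ^ 2)) := by
  rw [Metric.mem_closedBall, dist_zero_right] at hv'
  refine Real.exp_le_exp.2 ?_
  have h1 : ‖v - v'‖ ^ 2 ≤ (‖v‖ + ‖v'‖) ^ 2 :=
    pow_le_pow_left₀ (norm_nonneg _) (norm_sub_le v v') 2
  have h2 : ‖v'‖ ^ 2 ≤ R ^ 2 := pow_le_pow_left₀ (norm_nonneg _) hv' 2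
  have h3 : ‖v - v'‖ ^ 2 ≤ 2 * (‖v‖ ^ 2 + R ^ 2) := by
    nlinarith [h1, h2, sq_nonneg (‖v‖ - ‖v'‖)]
  have hϑ2 : 0 < ϑ ^ 2 := by positivity
  rw [div_le_div_iff₀ hϑ2 (by positivity), neg_mul, neg_mul, neg_le_neg_iff]
  nlinarith [h3, hϑ2.le]

/-- The Gaussian kernel `v′ ↦ e^{−‖v − v′‖²/(2ϑ²)}` is bounded by `1` in norm. [folklore] -/
theorem norm_exp_neg_norm_sub_sq_le_one (ϑ : ℝ) (v v' : V3) :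
    ‖Real.exp (-‖v - v'‖ ^ 2 / (2 * ϑ ^ 2))‖ ≤ 1 := by
  rw [Real.norm_eq_abs, abs_of_pos (Real.exp_pos _), ← Real.exp_zero]
  refine Real.exp_le_exp.2 ?_
  rw [neg_div, neg_nonpos]
  positivity

/-- The Gaussian kernel `v′ ↦ e^{−‖v − v′‖²/(2ϑ²)}` is integrable against a probability measure.
[folklore] -/
theorem integrable_exp_neg_norm_sub_sq (ν : Measure V3) [IsProbabilityMeasure ν] (ϑ : ℝ) (v : V3) :
    Integrable (fun v' : V3 => Real.exp (-‖v - v'‖ ^ 2 / (2 * ϑ ^ 2))) ν :=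
  (integrable_const (1 : ℝ)).mono' (Continuous.aestronglyMeasurable (by fun_prop))
    (Eventually.of_forall fun v' => norm_exp_neg_norm_sub_sq_le_one ϑ v v')

/-- **Quadratic bound on the log-KDE.** For a probability law `ν` on `V3` and a bandwidth `ϑ > 0`
there is `A` with `|log h_ϑ(v)| ≤ A + ‖v‖²/ϑ²` for all `v`, `h_ϑ(v) = ∫ M_{1,v,ϑ²} dν`: the upper
bound `h_ϑ ≤ (2πϑ²)^{−3/2}` and the lower bound obtained by restricting the Gaussian average to a
closed ball of positive `ν`-mass. [folklore] -/
theorem exists_abs_log_kde_le (ν : Measure V3) [IsProbabilityMeasure ν] {ϑ : ℝ} (hϑ : 0 < ϑ) :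
    ∃ A : ℝ, ∀ v : V3,
      |Real.log (∫ v', localMaxwellian 1 (ϑ ^ 2) v v' ∂ν)| ≤ A + (ϑ ^ 2)⁻¹ * ‖v‖ ^ 2 := by
  obtain ⟨R, hR⟩ := exists_measureReal_closedBall_pos ν
  have hCpos : 0 < (2 * Real.pi * ϑ ^ 2) ^ (-(Module.finrank ℝ V3 : ℝ) / 2) :=
    Real.rpow_pos_of_pos (by positivity) _
  refine ⟨|Real.log ((2 * Real.pi * ϑ ^ 2) ^ (-(Module.finrank ℝ V3 : ℝ) / 2))| +
    R ^ 2 / ϑ ^ 2 - Real.log (ν.real (Metric.closedBall (0 : V3) R)), fun v => ?_⟩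
  rw [ParityRigidity.integral_localMaxwellian_eq]
  have hint := integrable_exp_neg_norm_sub_sq ν ϑ v
  have hIpos : 0 < ∫ v', Real.exp (-‖v - v'‖ ^ 2 / (2 * ϑ ^ 2)) ∂ν :=
    ParityRigidity.integral_exp_neg_norm_sq_pos ν (by positivity) v
  -- upper bound
  have hI1 : ∫ v', Real.exp (-‖v - v'‖ ^ 2 / (2 * ϑ ^ 2)) ∂ν ≤ 1 := by
    have h := norm_integral_le_of_norm_le_const (μ := ν)
      (Eventually.of_forall fun v' => norm_exp_neg_norm_sub_sq_le_one ϑ v v')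
    rwa [probReal_univ, mul_one, Real.norm_eq_abs, abs_of_pos hIpos] at h
  -- lower bound
  have hI2 : Real.exp (-(‖v‖ ^ 2 + R ^ 2) / ϑ ^ 2) * ν.real (Metric.closedBall (0 : V3) R) ≤
      ∫ v', Real.exp (-‖v - v'‖ ^ 2 / (2 * ϑ ^ 2)) ∂ν :=
    calc Real.exp (-(‖v‖ ^ 2 + R ^ 2) / ϑ ^ 2) * ν.real (Metric.closedBall (0 : V3) R)
        ≤ ∫ v' in Metric.closedBall (0 : V3) R, Real.exp (-‖v - v'‖ ^ 2 / (2 * ϑ ^ 2)) ∂ν :=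
          setIntegral_ge_of_const_le_real measurableSet_closedBall (measure_ne_top ν _)
            (fun v' hv' => exp_neg_le_exp_neg_norm_sub_sq hϑ v v' hv') hint.integrableOn
      _ ≤ ∫ v', Real.exp (-‖v - v'‖ ^ 2 / (2 * ϑ ^ 2)) ∂ν :=
          setIntegral_le_integral hint (Eventually.of_forall fun v' => (Real.exp_pos _).le)
  have hlog_le : Real.log (∫ v', Real.exp (-‖v - v'‖ ^ 2 / (2 * ϑ ^ 2)) ∂ν) ≤ 0 :=
    Real.log_nonpos hIpos.le hI1
  have hlog_ge : -(‖v‖ ^ 2 + R ^ 2) / ϑ ^ 2 + Real.log (ν.real (Metric.closedBall (0 : V3) R)) ≤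
      Real.log (∫ v', Real.exp (-‖v - v'‖ ^ 2 / (2 * ϑ ^ 2)) ∂ν) := by
    have h := Real.log_le_log (mul_pos (Real.exp_pos _) hR) hI2
    rwa [Real.log_mul (Real.exp_pos _).ne' hR.ne', Real.log_exp] at h
  rw [Real.log_mul hCpos.ne' hIpos.ne']
  have hsplit : -(‖v‖ ^ 2 + R ^ 2) / ϑ ^ 2 = -((ϑ ^ 2)⁻¹ * ‖v‖ ^ 2) - R ^ 2 / ϑ ^ 2 := by ring
  calc |Real.log ((2 * Real.pi * ϑ ^ 2) ^ (-(Module.finrank ℝ V3 : ℝ) / 2)) +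
          Real.log (∫ v', Real.exp (-‖v - v'‖ ^ 2 / (2 * ϑ ^ 2)) ∂ν)|
        ≤ |Real.log ((2 * Real.pi * ϑ ^ 2) ^ (-(Module.finrank ℝ V3 : ℝ) / 2))| +
          |Real.log (∫ v', Real.exp (-‖v - v'‖ ^ 2 / (2 * ϑ ^ 2)) ∂ν)| := abs_add_le _ _
    _ ≤ _ := by
        rw [abs_of_nonpos hlog_le]
        linarith

/-! ## §2 The surprisal jump of a one-particle observable -/

/-- The jump `c(v) + c(w) − c(v′) − c(w′)` of a one-particle observable `c` across the collision
record `q = ((v, w), ω)`, `(v′, w′) = collide ω (v, w)`. -/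
def jump (c : V3 → ℝ) (q : (V3 × V3) × Metric.sphere (0 : V3) 1) : ℝ :=
  c q.1.1 + c q.1.2 - c (collide q.2 q.1).1 - c (collide q.2 q.1).2

/-- The jump is odd under the inverse collision `J q = (collide q.2 q.1, −q.2)`:
`collide (−ω) (collide ω p) = p`. [folklore] -/
theorem jump_inverseCollision (c : V3 → ℝ) (q : (V3 × V3) × Metric.sphere (0 : V3) 1) :
    jump c (collide q.2 q.1, -q.2) = -jump c q := by
  simp only [jump, RateFloorGainSpreading.collide_neg_dir, collide_collide]
  ring

/-- The post-collisional pair `q ↦ collide q.2 q.1` is continuous on the record space.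
[folklore] -/
theorem continuous_postCollision :
    Continuous (fun q : (V3 × V3) × Metric.sphere (0 : V3) 1 => collide q.2 q.1) := by
  unfold collide
  fun_prop

/-- The jump of a measurable observable is measurable. [folklore] -/
theorem measurable_jump {c : V3 → ℝ} (hc : Measurable c) : Measurable (jump c) := by
  have hp : Measurable (fun q : (V3 × V3) × Metric.sphere (0 : V3) 1 => collide q.2 q.1) :=
    continuous_postCollision.measurable
  exact (((hc.comp (measurable_fst.comp measurable_fst)).add
    (hc.comp (measurable_snd.comp measurable_fst))).sub
    (hc.comp (measurable_fst.comp hp))).sub (hc.comp (measurable_snd.comp hp))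

/-- An observable of quadratic growth composed with a velocity read-out of at most the pair
energy is integrable against a finite record with finite second moments. [folklore] -/
theorem integrable_comp_of_abs_le_quadratic {c : V3 → ℝ} (hc : Measurable c) {A A' : ℝ}
    (hA' : 0 ≤ A') (hbound : ∀ v, |c v| ≤ A + A' * ‖v‖ ^ 2)
    (κ : Measure ((V3 × V3) × Metric.sphere (0 : V3) 1)) [IsFiniteMeasure κ]
    (hκ2 : Integrable (fun q : (V3 × V3) × Metric.sphere (0 : V3) 1 => ‖q.1.1‖ ^ 2 + ‖q.1.2‖ ^ 2) κ)
    {f : (V3 × V3) × Metric.sphere (0 : V3) 1 → V3} (hf : Measurable f)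
    (hfq : ∀ q, ‖f q‖ ^ 2 ≤ ‖q.1.1‖ ^ 2 + ‖q.1.2‖ ^ 2) :
    Integrable (fun q => c (f q)) κ := by
  refine Integrable.mono' (g := fun q => A + A' * (‖q.1.1‖ ^ 2 + ‖q.1.2‖ ^ 2))
    ((integrable_const A).add (hκ2.const_mul A')) (hc.comp hf).aestronglyMeasurable
    (Eventually.of_forall fun q => ?_)
  rw [Real.norm_eq_abs]
  calc |c (f q)| ≤ A + A' * ‖f q‖ ^ 2 := hbound _
    _ ≤ A + A' * (‖q.1.1‖ ^ 2 + ‖q.1.2‖ ^ 2) := by gcongr; exact hfq q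

/-- **Surprisal balance from collisional balance.** If `|c(v)| ≤ A + A′‖v‖²`, the record `κ` has
finite second moments and its gain marginals equal its loss marginals, then the jump of `c` is
`κ`-integrable with `∫ jump c dκ = 0` (energy conservation of `collide` + `integral_map`).
[folklore] -/
theorem integral_jump_eq_zero {c : V3 → ℝ} (hc : Measurable c) {A A' : ℝ} (hA' : 0 ≤ A')
    (hbound : ∀ v, |c v| ≤ A + A' * ‖v‖ ^ 2)
    (κ : Measure ((V3 × V3) × Metric.sphere (0 : V3) 1)) [IsFiniteMeasure κ]
    (hκ2 : Integrable (fun q : (V3 × V3) × Metric.sphere (0 : V3) 1 => ‖q.1.1‖ ^ 2 + ‖q.1.2‖ ^ 2) κ)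
    (hb : κ.map (fun q => (collide q.2 q.1).1) + κ.map (fun q => (collide q.2 q.1).2) =
      κ.map (fun q => q.1.1) + κ.map (fun q => q.1.2)) :
    Integrable (jump c) κ ∧ ∫ q, jump c q ∂κ = 0 := by
  have hp := continuous_postCollision.measurable
  have m1 : Measurable (fun q : (V3 × V3) × Metric.sphere (0 : V3) 1 => q.1.1) :=
    measurable_fst.comp measurable_fst
  have m2 : Measurable (fun q : (V3 × V3) × Metric.sphere (0 : V3) 1 => q.1.2) :=
    measurable_snd.comp measurable_fst
  have m3 : Measurable (fun q : (V3 × V3) × Metric.sphere (0 : V3) 1 => (collide q.2 q.1).1) :=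
    measurable_fst.comp hp
  have m4 : Measurable (fun q : (V3 × V3) × Metric.sphere (0 : V3) 1 => (collide q.2 q.1).2) :=
    measurable_snd.comp hp
  have e := fun q : (V3 × V3) × Metric.sphere (0 : V3) 1 =>
    norm_sq_collide_fst_add_norm_sq_collide_snd q.2 q.1
  have i1 : Integrable (fun q : (V3 × V3) × Metric.sphere (0 : V3) 1 => c q.1.1) κ :=
    integrable_comp_of_abs_le_quadratic hc hA' hbound κ hκ2 m1
      fun q => by nlinarith [sq_nonneg ‖q.1.2‖]
  have i2 : Integrable (fun q : (V3 × V3) × Metric.sphere (0 : V3) 1 => c q.1.2) κ :=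
    integrable_comp_of_abs_le_quadratic hc hA' hbound κ hκ2 m2
      fun q => by nlinarith [sq_nonneg ‖q.1.1‖]
  have i3 : Integrable (fun q : (V3 × V3) × Metric.sphere (0 : V3) 1 => c (collide q.2 q.1).1) κ :=
    integrable_comp_of_abs_le_quadratic hc hA' hbound κ hκ2 m3
      fun q => by nlinarith [sq_nonneg ‖(collide q.2 q.1).2‖, e q]
  have i4 : Integrable (fun q : (V3 × V3) × Metric.sphere (0 : V3) 1 => c (collide q.2 q.1).2) κ :=
    integrable_comp_of_abs_le_quadratic hc hA' hbound κ hκ2 m4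
      fun q => by nlinarith [sq_nonneg ‖(collide q.2 q.1).1‖, e q]
  have hint : Integrable (jump c) κ := ((i1.fun_add i2).sub' i3).sub' i4
  refine ⟨hint, ?_⟩
  -- push the four terms forward to `V3`
  have hmap : ∀ {f : (V3 × V3) × Metric.sphere (0 : V3) 1 → V3}, Measurable f →
      Integrable (fun q => c (f q)) κ →
      ∫ q, c (f q) ∂κ = ∫ v, c v ∂(κ.map f) ∧ Integrable c (κ.map f) := fun hf hi =>
    ⟨(integral_map hf.aemeasurable hc.aestronglyMeasurable).symm,
      (integrable_map_measure hc.aestronglyMeasurable hf.aemeasurable).2 hi⟩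
  obtain ⟨e1, j1⟩ := hmap m1 i1
  obtain ⟨e2, j2⟩ := hmap m2 i2
  obtain ⟨e3, j3⟩ := hmap m3 i3
  obtain ⟨e4, j4⟩ := hmap m4 i4
  have hsplit : ∫ q, jump c q ∂κ = (∫ q, c q.1.1 ∂κ) + (∫ q, c q.1.2 ∂κ) -
      (∫ q, c (collide q.2 q.1).1 ∂κ) - ∫ q, c (collide q.2 q.1).2 ∂κ := by
    unfold jump
    rw [integral_sub ((i1.fun_add i2).sub' i3) i4, integral_sub (i1.fun_add i2) i3, integral_add i1 i2]
  have hpre : (∫ q, c q.1.1 ∂κ) + (∫ q, c q.1.2 ∂κ) =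
      ∫ v, c v ∂(κ.map (fun q => q.1.1) + κ.map (fun q => q.1.2)) := by
    rw [integral_add_measure j1 j2, e1, e2]
  have hpost : (∫ q, c (collide q.2 q.1).1 ∂κ) + (∫ q, c (collide q.2 q.1).2 ∂κ) =
      ∫ v, c v ∂(κ.map (fun q => (collide q.2 q.1).1) + κ.map (fun q => (collide q.2 q.1).2)) := by
    rw [integral_add_measure j3 j4, e3, e4]
  rw [hb] at hpost
  linarith

/-! ## §3 `J`-invariance of the Metropolis-reweighted record -/

/-- **`J`-invariance of the reweighted record from vanishing odd integrals.** If every bounded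
continuous `J`-odd test integrates to zero against `min(1, e^{−G}) · κ` (written as an integral
against `κ`), then the finite measure `min(1, e^{−G}) · κ` is `J`-invariant
(`stub_mapInverseCollisionOfOddIntegrals`, p139072). [folklore] -/
theorem map_inverseCollision_withDensity_eq
    (κ : Measure ((V3 × V3) × Metric.sphere (0 : V3) 1)) [IsFiniteMeasure κ]
    {G : (V3 × V3) × Metric.sphere (0 : V3) 1 → ℝ} (hG : Measurable G)
    (ho : ∀ Ψ : (V3 × V3) × Metric.sphere (0 : V3) 1 → ℝ, Continuous Ψ →
      (∃ C : ℝ, ∀ q, |Ψ q| ≤ C) → (∀ q, Ψ (collide q.2 q.1, -q.2) = -Ψ q) →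
      ∫ q, Ψ q * min 1 (Real.exp (-(G q))) ∂κ = 0) :
    (κ.withDensity fun q => ENNReal.ofReal (min 1 (Real.exp (-G q)))).map
        (fun q => (collide q.2 q.1, -q.2)) =
      κ.withDensity fun q => ENNReal.ofReal (min 1 (Real.exp (-G q))) := by
  have hd_meas : Measurable fun q => ENNReal.ofReal (min 1 (Real.exp (-G q))) :=
    (measurable_const.min (Real.measurable_exp.comp hG.neg)).ennreal_ofReal
  haveI : IsFiniteMeasure (κ.withDensity fun q => ENNReal.ofReal (min 1 (Real.exp (-G q)))) := by
    refine isFiniteMeasure_withDensity_ofReal (HasFiniteIntegral.of_bounded (C := 1)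
      (Eventually.of_forall fun q => ?_))
    rw [Real.norm_eq_abs, abs_of_pos (ParityBandClosureDetailedBalance.min_one_exp_neg_pos _)]
    exact min_le_left _ _
  refine ParityBandClosureDetailedBalance.stub_mapInverseCollisionOfOddIntegrals _ inferInstance ?_
  intro Ψ hΨc hΨb hΨo
  rw [integral_withDensity_eq_integral_toReal_smul hd_meas
    (Eventually.of_forall fun _ => ENNReal.ofReal_lt_top), ← ho Ψ hΨc hΨb hΨo]
  refine integral_congr_ae (Eventually.of_forall fun q => ?_)
  dsimp only
  rw [smul_eq_mul, ENNReal.toReal_ofReal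
    (ParityBandClosureDetailedBalance.min_one_exp_neg_pos _).le, mul_comm]

/-! ## §4 The stub -/

/-- **STUB `stub_exactParityRigidity` (line `transfer-weighted-parity-chain`, crux
`ParityBandClosure`, stmt-17608): exact parity rigidity.** A probability law on `ℝ³` with finite
second moment whose Metropolis-reweighted collision record has vanishing `J`-odd integrals at every
bandwidth `ϑ ∈ (0, 1)`, dominates the ideal contact law, and is collisionally balanced, has a mean
and exactly isotropic central second moments (composition of p139072, p138663, p139366, p137939
with the log-KDE bound `exists_abs_log_kde_le` and the balance `integral_jump_eq_zero`).
[folklore] -/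
theorem stub_exactParityRigidity : ExactParityRigidity := by
  intro ν _ κ _ hν2 hκ2 h F ho hf hb
  apply ParityBandClosureIsotropy.stub_isotropyOfVanishingProduction ν hν2
  intro h' F'
  refine ⟨1, one_pos, fun ϑ hϑ => ?_⟩
  obtain ⟨hϑ0, hϑ1⟩ := hϑ
  -- the one-particle observable `c = log ∘ h_ϑ` and its quadratic bound
  set c : V3 → ℝ := fun v => Real.log (∫ v', localMaxwellian 1 (ϑ ^ 2) v v' ∂ν) with hc_def
  have hc : Measurable c :=
    Real.measurable_log.comp (ParityRigidity.measurable_integral_localMaxwellian ν ϑ)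
  obtain ⟨A, hA⟩ := exists_abs_log_kde_le ν hϑ0
  -- (2) surprisal balance, (3) oddness, (4) `J`-invariance of the reweighted record
  obtain ⟨hint, hbal⟩ := integral_jump_eq_zero hc (by positivity) hA κ hκ2 hb
  have hFm : Measurable (jump c) := measurable_jump hc
  have hinv := map_inverseCollision_withDensity_eq κ hFm (ho ϑ hϑ0 hϑ1)
  -- (5) detailed balance for the ideal contact law
  have hae : ∀ᵐ q ∂(((ν.prod ν).prod sphereMeasure).withDensity
      (fun q => ENNReal.ofReal (hardSphereKernel (q.1.2, q.1.1) q.2))), jump c q = 0 :=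
    ParityBandClosureDetailedBalance.stub_detailedBalanceOfSymmetricRecord κ _ (jump c)
      inferInstance hFm ⟨jump_inverseCollision c, hinv⟩ hint hbal hf
  -- (6) the even production vanishes at bandwidth `ϑ`
  have hmeasU : Measurable (Function.uncurry fun (ω : Metric.sphere (0 : V3) 1) (p : V3 × V3) =>
      jump c (p, ω)) :=
    hFm.comp (measurable_snd.prodMk measurable_fst)
  exact ParityBandClosureIsotropy.stub_productionZeroOfDetailedBalance ν (fun ω p => jump c (p, ω))
    inferInstance hmeasU (hae.mono fun q hq => hq)

end Summit.AtomisticToContinuum.HydrodynamicLimit.Theorems.ParityBandClosureExactRigidity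

end
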